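import Summits.NavierStokesRegularity.FluidComputer.PalasekTowerLundgrenChildSwirlBurgersBracket
import Summits.NavierStokesRegularity.FluidComputer.PalasekTowerLundgrenChildSwirlRelaxationNonneg

/-!
# REGISTER v2.3″ (continued): THE SPEED FACE PINNED FOR THE CO-SIGNED CLASS — after the entropy clock the
# swirl of a Lundgren-carried child with ANY non-negative cross-section lies in the BURGERS BRACKET
# `[(0.0502 − δ), (0.0563 + δ)] · Γ (λA_k)^{1/2}` (ratio `< 5/3` for `δ ≤ 1/100`)

Cell `ns-blowup`, seat `ns-blowup-ecbridge-8` (g10); evidence toward crux 20305 `HeredityFromTwoT`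
(standing record 19250 `HeredityFromTwo`), SPEED face, MODEL lane «child core = cross-section of
Lundgren's stretched flow in the host strain `c = λA_k` at `ν = 1`». This is the file
`PalasekTowerLundgrenChildSwirlBurgersBracket` (g9) with its class hypothesis — POSITIVE and LOG-TAME
cross-section at all planar times (refuter4 K197 rider R2) — replaced by the hand-over condition
**`ω̃(0) ≥ 0`, `Γ = ∫ ω̃(0) > 0`** (co-signed cross-section), through
`palasekTowerBreakdown_cosigned_childSwirl_relaxation_after_one_strain_time`
(`PalasekTowerLundgrenChildSwirlRelaxationNonneg`, resting on the Literature theorems of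
`PlanarVorticityEntropyNonneg` / `PlanarVorticityEntropyVelocity` §5). Statements and proofs are otherwise
VERBATIM; with the clock defect `D(s) = 0.52 (Γc)^{1/2}(2ΓH₀)^{1/4} e^{−cs/4}` (`cs ≥ 1`):

* `palasekTowerBreakdown_cosigned_childSwirl_le_burgersPeak_clock` — ceiling `‖swirl(s, y)‖ ≤ Γc^{1/2}/(4π√2) + D(s)`;
* `palasekTowerBreakdown_cosigned_childSwirl_ge_burgersPeak_clock` — floor `‖swirl(s, y)‖ ≥ (79/125)·Γc^{1/2}/(4π) − D(s)`
  at SOME `y`;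
* `palasekTowerBreakdown_cosigned_childSwirl_burgersBracket` — once `0.52(2ΓH₀)^{1/4} ≤ δΓ^{1/2}e^{cs/4}`:
  **`(0.0502 − δ)·Γ(λA_k)^{1/2} ≤ sup_y ‖swirl(s, y)‖ ≤ (0.0563 + δ)·Γ(λA_k)^{1/2}`**.

REGISTER READING: the g9 conclusion «for positive log-tame cross-sections the any-profile speed band
collapses onto the Burgers bracket, ratio 1.65 < 5/3 at δ = 1/100» now holds for EVERY CO-SIGNED hand-over
cross-section in the uniform rapid-decay class. WHAT THIS IS NOT: not NS about registered flows; no Stage;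
MODEL identification; sign-changing cross-sections out of scope; the bracket's own width
(`0.0563/0.0502 = 1.12`) is the tree's elementary Burgers-peak bracket, not the printed sharp peak `0.0508`.

## References
* [cite: GallayWayne2005, §3.4 (arXiv:math/0402449 p. 14)] · [cite: GallayWayne2006, §1 eq. (1.5)]
* [cite: MajdaBertozziCUP2002, §2.2.1 Example 2.1 eq. (2.14) (held text p. 45)]
* [cite: Saffman1992, §13.1 eq. (4) and §13.3 eq. (31) (the Burgers peak `0.0508·Γ(γ/ν)^{1/2}`)]
-/

noncomputable section

namespace Summit.NavierStokesRegularity.FluidComputer.PalasekTowerClayBridge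

open Real Set MeasureTheory
open Literature.Analysis.FluidPDE Literature.Analysis.FluidPDE.Lundgren

variable {S' : Set ℝ}
  {v : ℝ → EuclideanSpace ℝ (Fin 2) → EuclideanSpace ℝ (Fin 2)}
  {q : ℝ → EuclideanSpace ℝ (Fin 2) → ℝ}

open SwirlBurgersBracket

/-! ### §1 Ceiling and floor after one strain time -/

/-- **CEILING: `‖swirl(s, y)‖ ≤ Γc^{1/2}/(4π√2) + 0.52(Γc)^{1/2}(2ΓH₀)^{1/4}e^{−cs/4}`** (setting of
`…_childSwirl_relaxation_after_one_strain_time`, `cs ≥ 1`): the child swirl is within the clock defect of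
`K₂ ∗ (ω_B ∘ ι) = π ∘ v_B ∘ ι`, and `‖v_B‖ ≤ Γc^{1/2}/(4π√2)` everywhere (`norm_burgersVortexSwirl_le_peak`).
[cite: GallayWayne2005, §3.4; GallayWayne2006, §1 eq. (1.5); Saffman1992, §13.1 eq. (4)] -/
theorem palasekTowerBreakdown_cosigned_childSwirl_le_burgersPeak_clock (R : TowerRates) (k : ℕ)
    {l : ℝ} (hl : 0 < l) (hS' : Convex ℝ S') (hv : IsClassicalNSSolutionOn S' 1 0 v q)
    (hω : HasUniformRapidDecayOn S' (fun σ η => PlanarEigenmode.vorticity (v σ) η))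
    (hBS : ∀ σ ∈ S', ∀ η, v σ η = biotSavart2D (PlanarEigenmode.vorticity (v σ)) η)
    (h0 : (0 : ℝ) ∈ S') (h0nn : ∀ η, 0 ≤ PlanarEigenmode.vorticity (v 0) η)
    (hΓ : 0 < ∫ y, PlanarEigenmode.vorticity (v 0) y) {s : ℝ} (hs1 : 1 ≤ l * R.A k * s)
    (hτs : (exp (l * R.A k * s) - 1) / (l * R.A k) ∈ S') (y : EuclideanSpace ℝ (Fin 2)) :
    ‖exp (l * R.A k * s / 2) • v ((exp (l * R.A k * s) - 1) / (l * R.A k)) (exp (l * R.A k * s / 2) • y)‖ ≤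
      (Real.sqrt 2)⁻¹ * ((∫ η, PlanarEigenmode.vorticity (v 0) η) * Real.sqrt (l * R.A k) / (4 * π)) +
        0.52 * Real.sqrt ((∫ η, PlanarEigenmode.vorticity (v 0) η) * (l * R.A k)) *
          Real.sqrt (Real.sqrt (2 * (∫ η, PlanarEigenmode.vorticity (v 0) η) *
            ∫ η, PlanarEigenmode.vorticity (v 0) η *
              Real.log (PlanarEigenmode.vorticity (v 0) η /
                ((∫ y, PlanarEigenmode.vorticity (v 0) y) / (4 * π * (l * R.A k)⁻¹) *
                  exp (-(‖η‖ ^ 2 / (4 * (l * R.A k)⁻¹))))))) *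
          exp (-(l * R.A k * s / 4)) := by
  set c : ℝ := l * R.A k with hc
  have hcpos : 0 < c := mul_pos hl (R.A_pos k)
  set Γ : ℝ := ∫ η, PlanarEigenmode.vorticity (v 0) η with hΓdef
  have hΓ0 : 0 ≤ Γ := integral_nonneg fun η => h0nn η
  have hrel := palasekTowerBreakdown_cosigned_childSwirl_relaxation_after_one_strain_time R k hl hS' hv hω
    hBS h0 h0nn hΓ hs1 hτs y
  have hid := (biotSavart2D_burgersVorticity_slice hcpos one_pos Γ y).2
  have hpeak := (burgersVortexSwirl_peak_bracket hcpos one_pos Γ).1 (embedXY y)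
  rw [div_one, abs_of_nonneg hΓ0] at hpeak
  have hB : ‖biotSavart2D (fun y' => burgersVorticity c 1 Γ (embedXY y')) y‖ ≤
      (Real.sqrt 2)⁻¹ * (Γ * Real.sqrt c / (4 * π)) := by
    rw [hid, norm_projXY_burgersVortexSwirl]; exact hpeak
  have htri := norm_le_norm_add_norm_sub'
    (exp (c * s / 2) • v ((exp (c * s) - 1) / c) (exp (c * s / 2) • y))
    (biotSavart2D (fun y' => burgersVorticity c 1 Γ (embedXY y')) y)
  linarith

/-- **FLOOR: `‖swirl(s, y)‖ ≥ (79/125)·Γc^{1/2}/(4π) − 0.52(Γc)^{1/2}(2ΓH₀)^{1/4}e^{−cs/4}` AT SOME `y`**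
(same setting): at the projection of a point where the Burgers swirl reaches `(79/125)K`
(`exists_norm_burgersVortexSwirl_ge`, two core radii from the axis).
[cite: GallayWayne2005, §3.4; GallayWayne2006, §1 eq. (1.5); Saffman1992, §13.1 eq. (4)] -/
theorem palasekTowerBreakdown_cosigned_childSwirl_ge_burgersPeak_clock (R : TowerRates) (k : ℕ)
    {l : ℝ} (hl : 0 < l) (hS' : Convex ℝ S') (hv : IsClassicalNSSolutionOn S' 1 0 v q)
    (hω : HasUniformRapidDecayOn S' (fun σ η => PlanarEigenmode.vorticity (v σ) η))
    (hBS : ∀ σ ∈ S', ∀ η, v σ η = biotSavart2D (PlanarEigenmode.vorticity (v σ)) η)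
    (h0 : (0 : ℝ) ∈ S') (h0nn : ∀ η, 0 ≤ PlanarEigenmode.vorticity (v 0) η)
    (hΓ : 0 < ∫ y, PlanarEigenmode.vorticity (v 0) y) {s : ℝ} (hs1 : 1 ≤ l * R.A k * s)
    (hτs : (exp (l * R.A k * s) - 1) / (l * R.A k) ∈ S') :
    ∃ y : EuclideanSpace ℝ (Fin 2),
      (79 / 125) * ((∫ η, PlanarEigenmode.vorticity (v 0) η) * Real.sqrt (l * R.A k) / (4 * π)) -
          0.52 * Real.sqrt ((∫ η, PlanarEigenmode.vorticity (v 0) η) * (l * R.A k)) *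
            Real.sqrt (Real.sqrt (2 * (∫ η, PlanarEigenmode.vorticity (v 0) η) *
              ∫ η, PlanarEigenmode.vorticity (v 0) η *
                Real.log (PlanarEigenmode.vorticity (v 0) η /
                  ((∫ y, PlanarEigenmode.vorticity (v 0) y) / (4 * π * (l * R.A k)⁻¹) *
                    exp (-(‖η‖ ^ 2 / (4 * (l * R.A k)⁻¹))))))) *
            exp (-(l * R.A k * s / 4)) ≤
        ‖exp (l * R.A k * s / 2) • v ((exp (l * R.A k * s) - 1) / (l * R.A k)) (exp (l * R.A k * s / 2) • y)‖ := by
  set c : ℝ := l * R.A k with hc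
  have hcpos : 0 < c := mul_pos hl (R.A_pos k)
  set Γ : ℝ := ∫ η, PlanarEigenmode.vorticity (v 0) η with hΓdef
  have hΓ0 : 0 ≤ Γ := integral_nonneg fun η => h0nn η
  obtain ⟨x₃, hx₃⟩ := (burgersVortexSwirl_peak_bracket hcpos one_pos Γ).2
  rw [div_one, abs_of_nonneg hΓ0] at hx₃
  refine ⟨projXY x₃, ?_⟩
  have hrel := palasekTowerBreakdown_cosigned_childSwirl_relaxation_after_one_strain_time R k hl hS' hv hω
    hBS h0 h0nn hΓ hs1 hτs (projXY x₃)
  have hid := (biotSavart2D_burgersVorticity_slice hcpos one_pos Γ (projXY x₃)).2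
  have hB : (79 / 125) * (Γ * Real.sqrt c / (4 * π)) ≤
      ‖biotSavart2D (fun y' => burgersVorticity c 1 Γ (embedXY y')) (projXY x₃)‖ := by
    rw [hid, norm_projXY_burgersVortexSwirl, burgersVortexSwirl_embedXY_projXY]; exact hx₃
  have htri := norm_sub_norm_le
    (biotSavart2D (fun y' => burgersVorticity c 1 Γ (embedXY y')) (projXY x₃))
    (exp (c * s / 2) • v ((exp (c * s) - 1) / c) (exp (c * s / 2) • projXY x₃))
  rw [norm_sub_rev] at htri
  linarith

/-! ### §2 The Burgers bracket as numbers -/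

/-- **THE SPEED FACE PINNED TO THE BURGERS BRACKET** (same setting; `cs ≥ 1`): once
`0.52 (2ΓH₀)^{1/4} ≤ δ Γ^{1/2} e^{cs/4}` (after `λA_k s ≥ log(0.1462·H₀/Γ) + 4 log(1/δ)` strain times),
**`‖swirl(s, y)‖ ≤ (0.0563 + δ)·Γ(λA_k)^{1/2}` at every `y`, and `‖swirl(s, y)‖ ≥ (0.0502 − δ)·Γ(λA_k)^{1/2}` at
some `y`** (`1/(4π√2) ≤ 0.0563`, `(79/125)/(4π) ≥ 0.0502`). For `δ = 1/100` the ratio of the two constants is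
`0.0663/0.0402 < 5/3 = c₂/c₁`. MODEL statement; not about any registered flow.
[cite: GallayWayne2005, §3.4; Saffman1992, §13.1 eq. (4) and §13.3 eq. (31)] -/
theorem palasekTowerBreakdown_cosigned_childSwirl_burgersBracket (R : TowerRates) (k : ℕ)
    {l : ℝ} (hl : 0 < l) (hS' : Convex ℝ S') (hv : IsClassicalNSSolutionOn S' 1 0 v q)
    (hω : HasUniformRapidDecayOn S' (fun σ η => PlanarEigenmode.vorticity (v σ) η))
    (hBS : ∀ σ ∈ S', ∀ η, v σ η = biotSavart2D (PlanarEigenmode.vorticity (v σ)) η)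
    (h0 : (0 : ℝ) ∈ S') (h0nn : ∀ η, 0 ≤ PlanarEigenmode.vorticity (v 0) η)
    (hΓ : 0 < ∫ y, PlanarEigenmode.vorticity (v 0) y) {s : ℝ} (hs1 : 1 ≤ l * R.A k * s)
    (hτs : (exp (l * R.A k * s) - 1) / (l * R.A k) ∈ S') {δ : ℝ}
    (hclock : 0.52 * Real.sqrt (Real.sqrt (2 * (∫ η, PlanarEigenmode.vorticity (v 0) η) *
          ∫ η, PlanarEigenmode.vorticity (v 0) η *
            Real.log (PlanarEigenmode.vorticity (v 0) η /
              ((∫ y, PlanarEigenmode.vorticity (v 0) y) / (4 * π * (l * R.A k)⁻¹) *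
                exp (-(‖η‖ ^ 2 / (4 * (l * R.A k)⁻¹))))))) ≤
        δ * Real.sqrt (∫ η, PlanarEigenmode.vorticity (v 0) η) * exp (l * R.A k * s / 4)) :
    (∀ y : EuclideanSpace ℝ (Fin 2),
        ‖exp (l * R.A k * s / 2) • v ((exp (l * R.A k * s) - 1) / (l * R.A k)) (exp (l * R.A k * s / 2) • y)‖ ≤
          (0.0563 + δ) * ((∫ η, PlanarEigenmode.vorticity (v 0) η) * Real.sqrt (l * R.A k))) ∧
      ∃ y : EuclideanSpace ℝ (Fin 2),
        (0.0502 - δ) * ((∫ η, PlanarEigenmode.vorticity (v 0) η) * Real.sqrt (l * R.A k)) ≤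
          ‖exp (l * R.A k * s / 2) • v ((exp (l * R.A k * s) - 1) / (l * R.A k)) (exp (l * R.A k * s / 2) • y)‖ := by
  set c : ℝ := l * R.A k with hc
  have hcpos : 0 < c := mul_pos hl (R.A_pos k)
  set Γ : ℝ := ∫ η, PlanarEigenmode.vorticity (v 0) η with hΓdef
  have hΓ0 : 0 ≤ Γ := integral_nonneg fun η => h0nn η
  set D : ℝ := 0.52 * Real.sqrt (Γ * c) * Real.sqrt (Real.sqrt (2 * Γ *
    ∫ η, PlanarEigenmode.vorticity (v 0) η *
      Real.log (PlanarEigenmode.vorticity (v 0) η /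
        (Γ / (4 * π * c⁻¹) * exp (-(‖η‖ ^ 2 / (4 * c⁻¹))))))) * exp (-(c * s / 4)) with hD
  -- the defect is `≤ δ Γ √c`
  have hunit : 0 ≤ Γ * Real.sqrt c := by positivity
  have hDδ : D ≤ δ * (Γ * Real.sqrt c) := by
    have hee : exp (c * s / 4) * exp (-(c * s / 4)) = 1 := by
      rw [← Real.exp_add, add_neg_cancel, Real.exp_zero]
    have hΓΓ : Real.sqrt Γ * Real.sqrt Γ = Γ := Real.mul_self_sqrt hΓ0
    rw [hD, Real.sqrt_mul hΓ0 c]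
    calc 0.52 * (Real.sqrt Γ * Real.sqrt c) * Real.sqrt (Real.sqrt (2 * Γ * _)) * exp (-(c * s / 4))
        = (0.52 * Real.sqrt (Real.sqrt (2 * Γ * _))) * (Real.sqrt Γ * Real.sqrt c * exp (-(c * s / 4))) := by
          ring
      _ ≤ (δ * Real.sqrt Γ * exp (c * s / 4)) * (Real.sqrt Γ * Real.sqrt c * exp (-(c * s / 4))) :=
          mul_le_mul_of_nonneg_right hclock (by positivity)
      _ = δ * (Real.sqrt Γ * Real.sqrt Γ) * Real.sqrt c * (exp (c * s / 4) * exp (-(c * s / 4))) := by ring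
      _ = δ * (Γ * Real.sqrt c) := by rw [hee, hΓΓ]; ring
  have hK1 : (Real.sqrt 2)⁻¹ * (Γ * Real.sqrt c / (4 * π)) ≤ 0.0563 * (Γ * Real.sqrt c) := by
    have := mul_le_mul_of_nonneg_right inv_sqrt_two_div_four_pi_le hunit
    calc (Real.sqrt 2)⁻¹ * (Γ * Real.sqrt c / (4 * π)) = (Real.sqrt 2)⁻¹ * (1 / (4 * π)) * (Γ * Real.sqrt c) := by
          ring
      _ ≤ 0.0563 * (Γ * Real.sqrt c) := this
  have hK2 : 0.0502 * (Γ * Real.sqrt c) ≤ (79 / 125) * (Γ * Real.sqrt c / (4 * π)) := by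
    have := mul_le_mul_of_nonneg_right peak_floor_const_ge hunit
    calc 0.0502 * (Γ * Real.sqrt c) ≤ (79 / 125 : ℝ) * (1 / (4 * π)) * (Γ * Real.sqrt c) := this
      _ = (79 / 125) * (Γ * Real.sqrt c / (4 * π)) := by ring
  refine ⟨fun y => ?_, ?_⟩
  · have h := palasekTowerBreakdown_cosigned_childSwirl_le_burgersPeak_clock R k hl hS' hv hω hBS h0 h0nn
      hΓ hs1 hτs y
    linarith
  · obtain ⟨y, hy⟩ := palasekTowerBreakdown_cosigned_childSwirl_ge_burgersPeak_clock R k hl hS' hv hω hBS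
      h0 h0nn hΓ hs1 hτs
    exact ⟨y, by linarith⟩

end Summit.NavierStokesRegularity.FluidComputer.PalasekTowerClayBridge

end
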